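import Mathlib
import Summits.Parity.GeneralizedHardyLittlewood.Theorems.LiouvilleShiftedTablesPairsFromMAvgCoprimeSums
import Summits.Parity.GeneralizedHardyLittlewood.Theorems.LiouvilleShiftedTablesPairsFromMAvgDecomposition
import Summits.Parity.GeneralizedHardyLittlewood.Theorems.LiouvilleShiftedTablesPairsFromMAvgPieces
import Summits.Parity.GeneralizedHardyLittlewood.Theorems.LiouvilleShiftedTablesPairsFromMAvgGrowth

/-!
# `PairsFromMAvg` (stmt-Parity-14275): Bombieri's asymptotic sieve at level 1 for `Λ(n + h)`

Route `LiouvilleShiftedTables` (Parity / GeneralizedHardyLittlewood). The support item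
`Summit.Parity.GeneralizedHardyLittlewood.Theses.LiouvilleShiftedTables.PairsFromMAvg`:

  `EH → MAvg → ∀ h ≥ 1, ∑_{n ≤ N} Λ(n)Λ(n+h) = 𝔖({0,h}) N + o(N)`,

where `EH` is the Elliott–Halberstam conjecture (level `x^θ` for every `θ < 1`, the tree's
`Literature.NumberTheory.Sieve.LevelOfDistribution.ElliottHalberstam` verbatim) and `MAvg` is Bombieri's
level-1 residual `∑_{m ≤ x^ε} log m |∑_{d ≤ x/m} μ(d)Λ(dm+h)| = o(x)` (some `ε = ε(h) > 0`).

Proof (`PairsFromMAvg_proof`), all bookkeeping PROVED in parts 1–9 of this series: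
`Λ = μ ⋆ log` gives `∑_{n ≤ N} Λ(n)Λ(n+h) = P₁ + ∑_{d ≤ D₁} μ(d) T_d` (part 5; `M₀ = ⌊N^ε⌋`,
`D₁ = ⌊N/(M₀+1)⌋`, `ε` shrunk to `≤ 1/2` using the nonnegativity of the `MAvg` summands); `|P₁| ≤ MAvg(N) = o(N)`;
for `(d, h) = 1`, `T_d = (d/φ(d)) ∑_{M₀<m≤N/d} log m + O(E*(N+h; d) log N)` by Abel summation against
`ψ(·; d, h)` (part 6), and `∑_{d ≤ D₁} E*(N+h; d) ≪ N (log N)^{-2}` by `EH` at `θ = 1 − ε/2` since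
`D₁ ≤ N^{1−ε}` (part 8); the moduli with `(d,h) > 1` give `O(D₁ log² N)`; the main term is
`N(log N − 1)S₁ − NS₂ − (M₀ log M₀ − M₀)S₃ + O(D₁ log³ N)` (part 7) with
`S₁ = ∑_{d ≤ D₁,(d,h)=1} μ(d)/φ(d) ≪ (log N)⁻²`, `S₃ = ∑ μ(d)d/φ(d) ≪ D₁(log N)⁻²` and
`S₂ = ∑ μ(d) log d/φ(d) → −𝔖({0,h})` (parts 1–4, from the prime number theorem for `μ` PROVED in the
tree and the Euler product of `𝔖`). Every error is `O(N/log N)` or `O(N^{1−ε} log³ N)`, hence `o(N)`.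
[cite: BombieriAsymptoticSieve1976, Theorem 1 (k = 1 bookkeeping); GoldstonYildirim2001, Lemma 2.1]
-/

noncomputable section

open Finset Real ArithmeticFunction Filter Asymptotics
open scoped ArithmeticFunction.Moebius Topology

namespace Summit.Parity.GeneralizedHardyLittlewood.Theorems

open PairsFromMAvg
open Literature.NumberTheory.Sieve (primeAPError primeAPError_nonneg singularSeries)
open Summit.Parity.GeneralizedHardyLittlewood.Theses.LiouvilleShiftedTables (EH MAvg)

namespace PairsFromMAvg

/-- From an eventual bound `|g(N)| ≤ C N/log N` to `g = o(N)`. [folklore] -/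
theorem isLittleO_of_le_mul_div_log {g : ℕ → ℝ} (C : ℝ)
    (hg : ∀ᶠ N : ℕ in atTop, |g N| ≤ C * ((N : ℝ) / Real.log N)) :
    g =o[atTop] fun N : ℕ => (N : ℝ) := by
  refine IsBigO.trans_isLittleO (IsBigO.of_bound C ?_) isLittleO_div_log_self
  filter_upwards [hg, eventually_ge_atTop 2] with N hN hN2
  have hlog : 0 < Real.log N := Real.log_pos (by exact_mod_cast hN2)
  rw [Real.norm_eq_abs, Real.norm_eq_abs,
    abs_of_nonneg (show (0 : ℝ) ≤ (N : ℝ) / Real.log N by positivity)]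
  exact hN

/-- From `u(N) → 0` to `N · u(N) = o(N)`. [folklore] -/
theorem isLittleO_mul_of_tendsto_zero {u : ℕ → ℝ} (hu : Tendsto u atTop (𝓝 0)) :
    (fun N : ℕ => (N : ℝ) * u N) =o[atTop] fun N : ℕ => (N : ℝ) := by
  have h1 : u =o[atTop] fun _ : ℕ => (1 : ℝ) := (isLittleO_one_iff ℝ).mpr hu
  have h2 := h1.mul_isBigO (isBigO_refl (fun N : ℕ => (N : ℝ)) atTop)
  simp only [one_mul] at h2
  exact h2.congr' (Eventually.of_forall fun N => mul_comm _ _) EventuallyEq.rfl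

end PairsFromMAvg

set_option maxHeartbeats 800000 in
-- the assembly of seven `o(N)` estimates in one declaration exceeds the default budget (~2.5×)
/-- **`PairsFromMAvg`** (stmt-Parity-14275): `EH → MAvg → PairsHL` — Bombieri's asymptotic sieve at
level 1 for `a_n = Λ(n + h)`, all shifts `h ≥ 1`.
[cite: BombieriAsymptoticSieve1976, Theorem 1 (k = 1 bookkeeping)] -/
theorem PairsFromMAvg_proof :
    Summit.Parity.GeneralizedHardyLittlewood.Theses.LiouvilleShiftedTables.PairsFromMAvg := by
  intro hE hM h hh
  have hh0 : h ≠ 0 := by omega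
  set 𝔖 : ℝ := singularSeries ({0, (h : ℤ)} : Finset ℤ) with h𝔖
  -- `MAvg` at `h`, with `ε` shrunk to `≤ 1/2`
  obtain ⟨ε₁, hε₁, hMAvg⟩ := hM h hh
  set ε : ℝ := min ε₁ (1 / 2) with hεdef
  have hε0 : 0 < ε := lt_min hε₁ (by norm_num)
  have hε1 : ε ≤ ε₁ := min_le_left _ _
  have hε2 : ε ≤ 1 / 2 := min_le_right _ _
  -- the cut-offs and the pieces
  set M₀ : ℕ → ℕ := fun N => ⌊(N : ℝ) ^ ε⌋₊ with hM₀
  set D₁ : ℕ → ℕ := fun N => N / (M₀ N + 1) with hD₁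
  set P₁ : ℕ → ℝ := fun N => ∑ m ∈ Icc 1 (M₀ N), Real.log m *
    ∑ d ∈ Icc 1 (N / m), (μ d : ℝ) * Λ (d * m + h) with hP₁
  set T : ℕ → ℕ → ℝ := fun N d => ∑ m ∈ Ioc (M₀ N) (N / d), Real.log m * Λ (d * m + h) with hT
  set X : ℕ → ℕ → ℝ := fun N d => ∑ m ∈ Ioc (M₀ N) (N / d), Real.log (m : ℝ) with hX
  set A : ℕ → ℝ := fun N => ∑ d ∈ (Icc 1 (D₁ N)).filter (fun d => d.Coprime h),
    (μ d : ℝ) * (T N d - (d : ℝ) / Nat.totient d * X N d) with hA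
  set B : ℕ → ℝ := fun N => ∑ d ∈ (Icc 1 (D₁ N)).filter (fun d => ¬ d.Coprime h),
    (μ d : ℝ) * T N d with hB
  set MT : ℕ → ℝ := fun N => ∑ d ∈ (Icc 1 (D₁ N)).filter (fun d => d.Coprime h),
    (μ d : ℝ) * ((d : ℝ) / Nat.totient d) * X N d with hMT
  set S₁ : ℕ → ℝ := fun N => ∑ d ∈ (Icc 1 (D₁ N)).filter (fun d => d.Coprime h),
    (μ d : ℝ) / Nat.totient d with hS₁
  set S₂ : ℕ → ℝ := fun N => ∑ d ∈ (Icc 1 (D₁ N)).filter (fun d => d.Coprime h),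
    (μ d : ℝ) * Real.log d / Nat.totient d with hS₂
  set S₃ : ℕ → ℝ := fun N => ∑ d ∈ (Icc 1 (D₁ N)).filter (fun d => d.Coprime h),
    (μ d : ℝ) * d / Nat.totient d with hS₃
  set c₀ : ℕ → ℝ := fun N => (M₀ N : ℝ) * Real.log (M₀ N) - M₀ N with hc₀
  set Malg : ℕ → ℝ := fun N => MT N - ((N : ℝ) * (Real.log N - 1) * S₁ N - (N : ℝ) * S₂ N -
    c₀ N * S₃ N) with hMalg
  -- the decomposition identity
  have hident : ∀ N : ℕ, ∑ n ∈ Icc 1 N, Λ n * Λ (n + h) - 𝔖 * N =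
      P₁ N + A N + B N + Malg N + (N : ℝ) * (Real.log N - 1) * S₁ N -
        (N : ℝ) * (S₂ N + 𝔖) - c₀ N * S₃ N := by
    intro N
    have hMN : M₀ N ≤ N := floor_rpow_le_self hε0 (by linarith) N
    rw [sum_vonMangoldt_mul_shift_eq_add h hMN, largePart_eq_sum_Icc_div]
    have hsplit : ∑ d ∈ Icc 1 (N / (M₀ N + 1)), (μ d : ℝ) *
        ∑ m ∈ Ioc (M₀ N) (N / d), Real.log m * Λ (d * m + h) = (A N + MT N) + B N := by
      rw [← Finset.sum_filter_add_sum_filter_not (Icc 1 (N / (M₀ N + 1))) (fun d => d.Coprime h)]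
      congr 1
      rw [hA, hMT, ← Finset.sum_add_distrib]
      refine Finset.sum_congr rfl fun d _ => ?_
      ring
    rw [hsplit]
    simp only [hMalg, hP₁, hc₀]
    ring
  -- transfer to the pieces
  have hcongr : (fun N : ℕ => P₁ N + A N + B N + Malg N + (N : ℝ) * (Real.log N - 1) * S₁ N -
        (N : ℝ) * (S₂ N + 𝔖) - c₀ N * S₃ N) =ᶠ[atTop]
      fun N : ℕ => ∑ n ∈ Icc 1 N, Λ n * Λ (n + h) - 𝔖 * N :=
    Eventually.of_forall fun N => (hident N).symm
  refine IsLittleO.congr' ?_ hcongr EventuallyEq.rfl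
  -- common eventual facts
  have hev₁ : ∀ᶠ N : ℕ in atTop, h ≤ N ∧ 3 ≤ N ∧ 1 ≤ Real.log N := by
    filter_upwards [eventually_ge_atTop (max h 3)] with N hN
    refine ⟨le_of_max_le_left hN, le_of_max_le_right hN, ?_⟩
    have h3 : (3 : ℝ) ≤ N := by exact_mod_cast le_of_max_le_right hN
    rw [← Real.log_exp 1]
    exact Real.log_le_log (Real.exp_pos 1) (le_trans (by linarith [Real.exp_one_lt_d9]) h3)
  have hev₂ := eventually_div_large hε0 hε2
  have hev₃ := eventually_rpow_mul_log_le hε0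
  have hD₁le : ∀ N : ℕ, (D₁ N : ℝ) ≤ (N : ℝ) ^ (1 - ε) := fun N => cast_div_le_rpow ε N
  have hMD : ∀ N : ℕ, (M₀ N : ℝ) * D₁ N ≤ N := fun N => cast_mul_div_le N (M₀ N)
  -- (1) the small part: `MAvg`
  have hP₁o : P₁ =o[atTop] fun N : ℕ => (N : ℝ) := by
    have h1 := hMAvg.comp_tendsto tendsto_natCast_atTop_atTop
    refine IsBigO.trans_isLittleO (IsBigO.of_bound 1 (Eventually.of_forall fun N => ?_)) h1
    rw [one_mul, Real.norm_eq_abs, Function.comp_apply, Real.norm_eq_abs]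
    refine (abs_smallPart_le h (M₀ N) N).trans (le_trans ?_ (le_abs_self _))
    have hsub : Icc 1 (M₀ N) ⊆ Icc 1 ⌊(N : ℝ) ^ ε₁⌋₊ :=
      Finset.Icc_subset_Icc le_rfl (floor_rpow_mono hε0 hε1 N)
    refine le_trans (Finset.sum_le_sum_of_subset_of_nonneg hsub fun m _ _ =>
      mul_nonneg (Real.log_natCast_nonneg m) (abs_nonneg _)) (le_of_eq ?_)
    refine Finset.sum_congr rfl fun m _ => ?_
    rw [Nat.floor_div_eq_div]
  -- (2) the Abel errors: `EH`
  have hAo : A =o[atTop] fun N : ℕ => (N : ℝ) := by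
    have hEH : Literature.NumberTheory.Sieve.LevelOfDistribution.ElliottHalberstam := hE
    have hlev := hEH (1 - ε / 2) (by linarith) 2 two_pos (ε / 2) (by linarith)
    obtain ⟨C, hC⟩ := hlev.bound
    have hxN : Tendsto (fun N : ℕ => ((N + h : ℕ) : ℝ)) atTop atTop :=
      tendsto_natCast_atTop_atTop.comp (tendsto_add_atTop_nat h)
    refine isLittleO_of_le_mul_div_log (16 * max C 0) ?_
    filter_upwards [hev₁, hxN.eventually hC] with N ⟨hNh, hN3, hlogN⟩ hN
    set x : ℝ := ((N + h : ℕ) : ℝ) with hx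
    have hN0 : (0 : ℝ) < N := by exact_mod_cast (show 0 < N by omega)
    have hNx : (N : ℝ) ≤ x := by rw [hx]; exact_mod_cast Nat.le_add_right N h
    have hx2N : x ≤ 2 * N := by
      rw [hx]; push_cast
      have : (h : ℝ) ≤ N := by exact_mod_cast hNh
      linarith
    have hx1 : 1 < x := by linarith [show (3 : ℝ) ≤ N by exact_mod_cast hN3]
    have hlogx : Real.log N ≤ Real.log x := Real.log_le_log hN0 hNx
    have hlogx0 : 0 < Real.log x := by linarith
    have hexp : (1 : ℝ) - ε / 2 - ε / 2 = 1 - ε := by ring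
    rw [hexp, Real.norm_eq_abs, Real.norm_eq_abs, Real.rpow_two,
      abs_of_nonneg (Finset.sum_nonneg fun q _ => primeAPError_nonneg x q),
      abs_of_nonneg (by positivity)] at hN
    -- `D₁ N ≤ ⌊x^{1-ε}⌋`
    have hD₁x : D₁ N ≤ ⌊x ^ (1 - ε)⌋₊ := by
      refine Nat.le_floor ((hD₁le N).trans ?_)
      exact Real.rpow_le_rpow hN0.le hNx (by linarith)
    have hS : ∑ d ∈ Icc 1 (D₁ N), primeAPError x d ≤ max C 0 * (x / Real.log x ^ 2) :=
      calc ∑ d ∈ Icc 1 (D₁ N), primeAPError x d ≤ ∑ q ∈ Icc 1 ⌊x ^ (1 - ε)⌋₊, primeAPError x q :=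
            Finset.sum_le_sum_of_subset_of_nonneg (Finset.Icc_subset_Icc le_rfl hD₁x)
              fun q _ _ => primeAPError_nonneg x q
        _ ≤ C * (x / Real.log x ^ 2) := hN
        _ ≤ max C 0 * (x / Real.log x ^ 2) :=
            mul_le_mul_of_nonneg_right (le_max_left _ _) (by positivity)
    have hAN := abs_abelPart_le hh N (M₀ N) (le_refl x)
    calc |A N| ≤ 8 * Real.log N * ∑ d ∈ Icc 1 (D₁ N), primeAPError x d := hAN
      _ ≤ 8 * Real.log N * (max C 0 * (x / Real.log x ^ 2)) := by gcongr
      _ = 8 * max C 0 * (Real.log N / Real.log x) * (x / Real.log x) := by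
          field_simp
      _ ≤ 8 * max C 0 * 1 * (2 * N / Real.log N) := by
          gcongr
          exact (div_le_one hlogx0).mpr hlogx
      _ = 16 * max C 0 * (N / Real.log N) := by ring
  -- (3) the moduli not coprime to `h`
  have hBo : B =o[atTop] fun N : ℕ => (N : ℝ) := by
    refine isLittleO_of_le_mul_div_log 2 ?_
    filter_upwards [hev₁, hev₃] with N ⟨hNh, hN3, hlogN⟩ hN
    have hN0 : (0 : ℝ) < N := by exact_mod_cast (show 0 < N by omega)
    have hlog2 : Real.log ((N + h : ℕ) : ℝ) ≤ 2 * Real.log N := by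
      have h1 : ((N + h : ℕ) : ℝ) ≤ (N : ℝ) ^ 2 := by
        push_cast
        have : (h : ℝ) ≤ N := by exact_mod_cast hNh
        have : (3 : ℝ) ≤ N := by exact_mod_cast hN3
        nlinarith
      calc Real.log ((N + h : ℕ) : ℝ) ≤ Real.log ((N : ℝ) ^ 2) :=
            Real.log_le_log (by exact_mod_cast (show 0 < N + h by omega)) h1
        _ = 2 * Real.log N := by rw [Real.log_pow]; push_cast; ring
    have hBN := abs_nonCoprimePart_le hh0 N (M₀ N)
    calc |B N| ≤ (D₁ N : ℝ) * (Real.log N * Real.log ((N + h : ℕ) : ℝ)) := hBN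
      _ ≤ (N : ℝ) ^ (1 - ε) * (Real.log N * (2 * Real.log N)) := by gcongr; exact hD₁le N
      _ = 2 * ((N : ℝ) ^ (1 - ε) * Real.log N) * Real.log N := by ring
      _ ≤ 2 * ((N : ℝ) / Real.log N ^ 3) * Real.log N := by gcongr
      _ = 2 * ((N : ℝ) / Real.log N) * (1 / Real.log N) := by field_simp
      _ ≤ 2 * ((N : ℝ) / Real.log N) * 1 := by
          gcongr; exact (div_le_one (by linarith)).mpr hlogN
      _ = 2 * ((N : ℝ) / Real.log N) := mul_one _
  -- (4) the main-term algebra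
  have hMalgo : Malg =o[atTop] fun N : ℕ => (N : ℝ) := by
    refine isLittleO_of_le_mul_div_log 24 ?_
    filter_upwards [hev₁, hev₃] with N ⟨hNh, hN3, hlogN⟩ hN
    have hN0 : (0 : ℝ) < N := by exact_mod_cast (show 0 < N by omega)
    have hMN := abs_mainTerm_sub_le h N (M₀ N)
    have hD₁N : (D₁ N : ℝ) ≤ N := by exact_mod_cast Nat.div_le_self N (M₀ N + 1)
    have hlogD : Real.log (D₁ N) ≤ Real.log N := by
      rcases Nat.eq_zero_or_pos (D₁ N) with h0 | h0
      · rw [h0]; simp; linarith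
      · exact Real.log_le_log (by exact_mod_cast h0) hD₁N
    have hsum := sum_Icc_div_totient_le (D₁ N)
    calc |Malg N| ≤ 3 * (Real.log N + 1) * ∑ d ∈ Icc 1 (D₁ N), (d : ℝ) / Nat.totient d := hMN
      _ ≤ 3 * (Real.log N + 1) * ((D₁ N : ℝ) * (1 + Real.log (D₁ N)) ^ 2) := by gcongr
      _ ≤ 3 * (2 * Real.log N) * ((N : ℝ) ^ (1 - ε) * (2 * Real.log N) ^ 2) := by
          gcongr
          · linarith
          · exact hD₁le N
          · linarith
      _ = 24 * ((N : ℝ) ^ (1 - ε) * Real.log N) * Real.log N ^ 2 := by ring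
      _ ≤ 24 * ((N : ℝ) / Real.log N ^ 3) * Real.log N ^ 2 := by gcongr
      _ = 24 * ((N : ℝ) / Real.log N) := by field_simp
  -- (5) `N (log N − 1) S₁`
  have hS₁o : (fun N : ℕ => (N : ℝ) * (Real.log N - 1) * S₁ N) =o[atTop] fun N : ℕ => (N : ℝ) := by
    obtain ⟨C₁, hC₁⟩ := exists_abs_sum_coprime_moebius_div_totient_le hh0
    have hC₁0 : 0 ≤ C₁ := by
      have h64 := hC₁ 64 le_rfl
      have hl : 0 < Real.log (64 : ℕ) := Real.log_pos (by norm_num)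
      have := (abs_nonneg _).trans h64
      exact le_of_mul_le_mul_right (a := (Real.log (64 : ℕ) ^ 2)⁻¹)
        (by simpa [div_eq_mul_inv] using this) (by positivity)
    refine isLittleO_of_le_mul_div_log (16 * C₁) ?_
    filter_upwards [hev₁, hev₂] with N ⟨hNh, hN3, hlogN⟩ ⟨hD64, hlog4⟩
    have hN0 : (0 : ℝ) < N := by exact_mod_cast (show 0 < N by omega)
    have hlogD0 : 0 < Real.log (D₁ N) := by linarith
    have hb := hC₁ (D₁ N) hD64
    have hb' : |S₁ N| ≤ 16 * C₁ / Real.log N ^ 2 := by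
      calc |S₁ N| ≤ C₁ / Real.log (D₁ N) ^ 2 := hb
        _ ≤ C₁ / (Real.log N / 4) ^ 2 := by gcongr; linarith
        _ = 16 * C₁ / Real.log N ^ 2 := by field_simp; ring
    rw [abs_mul, abs_mul, abs_of_nonneg hN0.le]
    have hl1 : |Real.log N - 1| ≤ Real.log N := by
      rw [abs_le]; constructor <;> linarith
    calc (N : ℝ) * |Real.log N - 1| * |S₁ N| ≤ N * Real.log N * (16 * C₁ / Real.log N ^ 2) := by
          gcongr
      _ = 16 * C₁ * (N / Real.log N) := by field_simp
  -- (6) `N (S₂ + 𝔖)`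
  have hS₂o : (fun N : ℕ => (N : ℝ) * (S₂ N + 𝔖)) =o[atTop] fun N : ℕ => (N : ℝ) := by
    refine isLittleO_mul_of_tendsto_zero ?_
    have h1 := (tendsto_sum_coprime_moebius_mul_log_div_totient hh0).comp
      (tendsto_div_floor_rpow_atTop hε0 hε2)
    have h2 := h1.add_const 𝔖
    rw [h𝔖, neg_add_cancel] at h2
    exact h2
  -- (7) `c₀ S₃`
  have hS₃o : (fun N : ℕ => c₀ N * S₃ N) =o[atTop] fun N : ℕ => (N : ℝ) := by
    obtain ⟨C₃, hC₃⟩ := exists_abs_sum_coprime_moebius_mul_self_div_totient_le hh0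
    have hC₃0 : 0 ≤ C₃ := by
      have h64 := hC₃ 64 le_rfl
      have hl : 0 < Real.log (64 : ℕ) := Real.log_pos (by norm_num)
      have := (abs_nonneg _).trans h64
      have h2 : 0 ≤ C₃ * ((64 : ℕ) / Real.log (64 : ℕ) ^ 2) := by
        simpa [mul_div_assoc] using this
      exact le_of_mul_le_mul_right (by simpa using h2) (by positivity : (0 : ℝ) < (64 : ℕ) / Real.log (64 : ℕ) ^ 2)
    refine isLittleO_of_le_mul_div_log (32 * C₃) ?_
    filter_upwards [hev₁, hev₂] with N ⟨hNh, hN3, hlogN⟩ ⟨hD64, hlog4⟩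
    have hN0 : (0 : ℝ) < N := by exact_mod_cast (show 0 < N by omega)
    have hlogD0 : 0 < Real.log (D₁ N) := by linarith
    have hb := hC₃ (D₁ N) hD64
    have hb' : |S₃ N| ≤ 16 * C₃ * D₁ N / Real.log N ^ 2 := by
      calc |S₃ N| ≤ C₃ * D₁ N / Real.log (D₁ N) ^ 2 := hb
        _ ≤ C₃ * D₁ N / (Real.log N / 4) ^ 2 := by gcongr; linarith
        _ = 16 * C₃ * D₁ N / Real.log N ^ 2 := by field_simp; ring
    -- `|c₀| ≤ M₀ (log N + 1) ≤ 2 M₀ log N`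
    have hMN : M₀ N ≤ N := floor_rpow_le_self hε0 (by linarith) N
    have hM0 : (0 : ℝ) ≤ M₀ N := Nat.cast_nonneg _
    have hlogM : Real.log (M₀ N) ≤ Real.log N := by
      rcases Nat.eq_zero_or_pos (M₀ N) with h0 | h0
      · rw [h0]; simp; linarith
      · exact Real.log_le_log (by exact_mod_cast h0) (by exact_mod_cast hMN)
    have hlogM0 : 0 ≤ Real.log (M₀ N) := Real.log_natCast_nonneg _
    have hc : |c₀ N| ≤ 2 * (M₀ N : ℝ) * Real.log N := by
      simp only [hc₀]
      rw [abs_le]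
      constructor <;> nlinarith
    rw [abs_mul]
    calc |c₀ N| * |S₃ N| ≤ (2 * (M₀ N : ℝ) * Real.log N) * (16 * C₃ * D₁ N / Real.log N ^ 2) := by
          gcongr
      _ = 32 * C₃ * ((M₀ N : ℝ) * D₁ N) * (1 / Real.log N) := by field_simp; ring
      _ ≤ 32 * C₃ * N * (1 / Real.log N) := by gcongr; exact hMD N
      _ = 32 * C₃ * (N / Real.log N) := by ring
  -- assemble
  exact ((((((hP₁o.add hAo).add hBo).add hMalgo).add hS₁o).sub hS₂o).sub hS₃o)

end Summit.Parity.GeneralizedHardyLittlewood.Theorems
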